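import Mathlib
import Literature.MathematicalPhysics.QuantumFieldTheory.Balaban1983to89.B13PkScaling
import Literature.MathematicalPhysics.QuantumFieldTheory.Balaban1983to89.B13ExpansionOrder

/-!
# `Balaban1983to89.B13PkOrderEdges` — the EDGES of the (2.12)-census: the derived order constants of
# `B13ExpansionOrder` fed into the composite / scaling bookkeeping of `B13PkScaling`
# ([Balaban1987RG1] pp. 266–268, (2.12); [Balaban1988RG2Cluster] pp. 10–11, (1.42)–(1.43)), KERNEL-CHECKED

Paper sub-cell B13 of the Bałaban programme audit (cell `pub-balaban`), generation 13.  SIBLING of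
`B13PkScaling` (generation 12: the scaling `B = g_kB′`, the operator `Qop` of the quadratic form, `scaled g W`,
`quadraticForm_of_scaled_cubic` — *a `1/g_k²`-term whose `W` is analytic with a cubic bound `K` on `‖z‖ < R` is, on
`g_k|B| < ε₁`, `3ε₁ ≤ R`, the quadratic form of an operator of norm `≤ ½·27·K·ε₁`* — and the composite lemmas
`pow_bound_clm_comp`, `pow_bound_comp_clm`, `cubic_bilin_lin_quad`, `cubic_bilin_quad_quad`,
`cubic_comp_of_linear_bound`, all taking the ORDER PROPERTIES of `G₃`, `D̃`, `D̃₃`, `V` as HYPOTHESES `‖P z‖ ≤ K‖z‖ⁿ`)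
and of `B13ExpansionOrder` (generation 13: those hypotheses DERIVED from «analytic + bounded by `M` on a ball of
radius `R` + the print's qualitative onset order», constants `M/Rⁿ`, `2M/Rⁿ⁺¹`; `homPart f 2 w = ½∂_w∂_w f(0)`).
Both are imported; nothing in either is modified.  THIS FILE composes them: each census term's cubic constant and
its scaled quadratic-form bound are obtained from print-level data (analyticity, a sup bound, a vanishing jet or an
onset order, operator norms of the linear maps), with no hypothesised power bound left in between.  VALUE = kernel
bookkeeping certificate (the census edges elaborate against each other); NOT summit progress; NO disputed step of the
papers under audit is certified (existence / analyticity / onset orders of `D̃`, `G₃`, `V` remain the print's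
assertions, entering as hypotheses exactly as in the two parents).

CITATION HEADER (lean-in-tree rule 2026-08-18).  Sources (held; quotations READ AS IMAGES from the renders named in
the parents' headers — `b2b-balaban-ref1/pages/1987-cmp109-rg-I-small-field/…-p018/p019/p020-x2.png`,
`…/1988-cmp116-rg-II-cluster/…-p010-x2.png`, `…-p011-x2.png`; nothing is quoted here that is not quoted there):
* [Balaban1987RG1] = B12 = [I], Commun. Math. Phys. **109** (1987) 249–301: p. 266 *«The function G₃(B′) is an
  analytic function of B′, with an expansion beginning with third order terms, localized in blocks of the lattice
  T^{(k)}.»*, *«we decompose the function D into the sum D^{(2)} + D₃, where D^{(2)} is the second order term equal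
  to C^{(2)}, and D₃ is the higher order remainder.»*, (2.8) *«Denoting terms of at least third order in H₁B′ by
  V(H₁B′) we get»*; p. 267 *«D̃(B) has an expansion beginning with quadratic terms, and D̃^{(2)}(B) = C̃^{(2)}(B).»*,
  *«Next we make the scaling transformation B = g_kB′»*; p. 268 (2.12), the five `1/g_k²`-terms (census T3–T7)
  *«+ (1/g_k²)⟨H₁hD̃₃(g_kCB), J⟩ − (1/g_k²)G₃(g_kB) + (1/g_k²)⟨H₁g_kCB, Δ₁H₁hD̃(g_kCB)⟩
  − (1/g_k²)⟨H₁hD̃(g_kCB), Δ₁H₁hD̃(g_kCB)⟩ − (1/g_k²)V(H₁(g_kCB − hD̃(g_kCB)))»* and *«Let us remark that the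
  expression under the exponential above vanishes at g_k = 0»*.
* [Balaban1988RG2Cluster] = B13 = [II], Commun. Math. Phys. **116** (1988) 1–22 (`paper:balaban1988-cmp116-rg-ii-
  cluster`): p. 10 *«To cancel the factor 1/g_k² we expand (1.38) with respect to B′ up to the second order. The
  terms of zeroth and first order vanish, and the second order term is written as a quadratic form with coefficients
  given by second order derivatives of the function (1.38).»*; (1.42)–(1.43) p. 11 (quoted in `B13PkScaling`).

THE MODEL is the parents': `B`-configurations are points of a complex normed space `E`; `C`, `H₁`, `h`, `Δ₁`,
`⟨·, J⟩` are bounded (bi)linear maps between complex Banach spaces; `D̃ : F₁ → F₂` is analytic on `ball 0 R_D` with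
`‖D̃‖ ≤ M` there and the jet `D̃ 0 = 0`, `DD̃(0) = 0` ([II] p. 10) — or `BeginsAt D̃ 2` ([I] p. 267); `G₃`, `V` are
analytic, bounded, `BeginsAt · 3`.  `M`, `R`, `R_D`, `ε₁` are parameters, NOT printed numerics.

WHAT THIS FILE CERTIFIES ([folklore] throughout; term shapes [cite (2.12)]).
§1 PARTS ARE ANALYTIC.  `homPart f 2 w = ½·D²f(0) w w` with Mathlib's second Fréchet derivative
  (`homPart_two_eq_fderiv_fderiv`, from `B13ExpansionOrder.homPart_two_eq` + `B13PkScaling.d2_eq_fderiv_fderiv`), so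
  `w ↦ homPart f 2 w` is analytic on all of `E` (`analyticOnNhd_homPart_two`) and `rem f 2 = f − homPart f 2`
  (the typed `D̃₃`) is analytic on `f`'s ball (`analyticOnNhd_rem_two`) — the analyticity input of
  `quadraticForm_of_scaled_cubic` for T3.
§2 T4-TYPE EDGE (`−(1/g_k²)G₃(g_kB)`): `W` analytic with `‖W‖ ≤ M` on `ball 0 R` and `BeginsAt W 3` ⟹ on
  `‖g‖‖B‖ < ε₁`, `3ε₁ ≤ R`: `g⁻²W(gB) = Qop(B)(B, B)` with `‖Qop(B)‖ ≤ ½·27·(M/R³)·ε₁`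
  (`quadraticForm_of_scaled_beginsAt_three`); the same for the jet-3-free reading «third-order REMAINDER of an
  order-2 map»: `rem W 2` with constant `2M/R³` (`quadraticForm_of_scaled_rem_two`).
§3 T3 EDGE (`(1/g_k²)⟨H₁hD̃₃(g_kCB), J⟩`, before scaling `B ↦ A(D̃₃(CB))`, `A = ⟨H₁h·, J⟩`): with `‖C‖·R ≤ R_D`,
  `‖A(D̃₃(CB))‖ ≤ ‖A‖·(2M/R_D³)·‖C‖³·‖B‖³` on `ball 0 R` (`cubic_bound_T3`), the composite is analytic there
  (`analyticOnNhd_T3`), hence the scaled quadratic-form statement with `K = ‖A‖·(2M/R_D³)·‖C‖³` (`quadraticForm_T3`).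
§4 T5 / T6 EDGES (`⟨H₁g_kCB, Δ₁H₁hD̃(g_kCB)⟩`, `⟨H₁hD̃(g_kCB), Δ₁H₁hD̃(g_kCB)⟩`): the quadratic bound of `D̃ ∘ C`,
  `(M/R_D²)‖C‖²‖B‖²` (`quadratic_bound_comp_T56`), and the cubic constants `‖β‖·‖L₁‖·(‖A₂‖(M/R_D²)‖C‖²)`
  (`cubic_bound_T5`) and `‖β‖·(‖A₁‖b)(‖A₂‖b)·R`, `b = (M/R_D²)‖C‖²` (`cubic_bound_T6`).
§5 T7-TYPE EDGE, DERIVED VARIANT (`V(H₁B′)`, `B′ = Ψ(B)` with the linear-order bound (1.20) `‖Ψ w‖ ≤ λ‖w‖`): `V`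
  analytic, `‖V‖ ≤ M` on `ball 0 R_V`, `BeginsAt V 3`, `λR₀ ≤ R_V` ⟹ `‖V(Ψ w)‖ ≤ (M/R_V³)λ³‖w‖³` on `ball 0 R₀`
  (`cubic_bound_T7_derived`; the parent's `norm_Qop_T7_le` instead takes the PRINTED bound (1.39) via `Ineq139`).

NOT CERTIFIED HERE: as in the parents — existence / uniqueness / analyticity / domains / sup bounds / onset orders of
`D̃`, `G₃`, `V` (GAPS G-adv9-20 (a), G-B13-05a), `D̃^{(2)} = C̃^{(2)}`, localization, the polymer expansion (column
(b)), Lemma 2 of [II] beyond the one-term shape, and any numerical value of the constants.  The `D̃₃ := D̃ − D̃^{(2)}`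
reading is DIVERGENCE D-b13.24 (4).  Unit `b2b-balaban-b13-g13`; cell records GAPS C-B13-29, DIVERGENCE D-b13.24
(no new reading introduced here).
-/

set_option maxSynthPendingDepth 3

noncomputable section

namespace Literature.MathematicalPhysics.QuantumFieldTheory.Balaban1983to89.B13PkOrderEdges

open Metric Set Filter
open scoped Topology
open B13Ineq140 (d2)
open B13PkScaling (Qop scaled quadraticForm_of_scaled_cubic d2_eq_fderiv_fderiv pow_bound_clm_comp
  pow_bound_comp_clm mapsTo_ball_of_linear_bound cubic_bilin_lin_quad cubic_bilin_quad_quad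
  cubic_comp_of_linear_bound analyticOnNhd_bilin)
open B13ExpansionOrder (BeginsAt homPart rem beginsAt_two homPart_two_eq bounds_of_jet_two pow_bound_rem
  cubic_bound_of_beginsAt_three quadratic_bound_of_beginsAt_two)

variable {E F : Type*} [NormedAddCommGroup E] [NormedSpace ℂ E] [NormedAddCommGroup F] [NormedSpace ℂ F]

omit [NormedSpace ℂ E] [NormedSpace ℂ F] in
/-- A sup bound on a ball about `0` is non-negative. [folklore] -/
theorem nonneg_of_bound {f : E → F} {R M : ℝ} (hR : 0 < R) (hM : ∀ z ∈ ball (0 : E) R, ‖f z‖ ≤ M) : 0 ≤ M :=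
  (norm_nonneg _).trans (hM 0 (mem_ball_self hR))

/-! ## §1 The quadratic part and the remainder are analytic -/

section Parts

variable [CompleteSpace F]

/-- `homPart f 2 w = ½ · d2 f 0 w w` (the printed second partial derivative of [II] (1.40) on the diagonal).
[folklore] -/
theorem homPart_two_eq_d2 {f : E → F} {R : ℝ} (hR : 0 < R) (hf : AnalyticOnNhd ℂ f (ball 0 R)) (w : E) :
    homPart f 2 w = (2 : ℂ)⁻¹ • d2 f 0 w w :=
  homPart_two_eq hR hf w

/-- `homPart f 2 w = ½ · D²f(0) w w` with Mathlib's second Fréchet derivative: the slice-defined quadratic part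
*«D̃^{(2)}»* ([I] p. 267) is the value on the diagonal of a continuous bilinear map. [folklore] -/
theorem homPart_two_eq_fderiv_fderiv {f : E → F} {R : ℝ} (hR : 0 < R) (hf : AnalyticOnNhd ℂ f (ball 0 R))
    (w : E) : homPart f 2 w = (2 : ℂ)⁻¹ • fderiv ℂ (fderiv ℂ f) 0 w w := by
  rw [homPart_two_eq_d2 hR hf, d2_eq_fderiv_fderiv hf isOpen_ball (mem_ball_self hR)]

/-- The quadratic part `w ↦ homPart f 2 w` of a map analytic on a ball about `0` is analytic on the whole space
(it is `½·Q(w, w)` for the continuous bilinear `Q = D²f(0)`). [folklore] -/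
theorem analyticOnNhd_homPart_two {f : E → F} {R : ℝ} (hR : 0 < R) (hf : AnalyticOnNhd ℂ f (ball 0 R)) :
    AnalyticOnNhd ℂ (homPart f 2) univ := by
  have heq : homPart f 2 = fun w => (2 : ℂ)⁻¹ • fderiv ℂ (fderiv ℂ f) 0 w w :=
    funext (homPart_two_eq_fderiv_fderiv hR hf)
  rw [heq]
  intro w _
  have hβ : AnalyticAt ℂ (fun p : E × E => (fderiv ℂ (fderiv ℂ f) 0) p.1 p.2) (w, w) :=
    (fderiv ℂ (fderiv ℂ f) 0).analyticAt_bilinear (w, w)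
  exact analyticAt_const.smul (hβ.comp₂ analyticAt_id analyticAt_id)

/-- The remainder `rem f 2 = f − homPart f 2` (the typed *«D̃₃»*, D-b13.24 (4)) of a map analytic on `ball 0 R` is
analytic on `ball 0 R` — the analyticity input of `B13PkScaling.quadraticForm_of_scaled_cubic` for T3. [folklore] -/
theorem analyticOnNhd_rem_two {f : E → F} {R : ℝ} (hR : 0 < R) (hf : AnalyticOnNhd ℂ f (ball 0 R)) :
    AnalyticOnNhd ℂ (rem f 2) (ball 0 R) := by
  intro z hz
  have h1 : AnalyticAt ℂ f z := hf z hz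
  have h2 : AnalyticAt ℂ (homPart f 2) z := analyticOnNhd_homPart_two hR hf z (mem_univ _)
  exact h1.sub h2

end Parts

/-! ## §2 T4-type edge: a `1/g_k²`-term beginning with third-order terms -/

section T4

variable [CompleteSpace F]

/-- **T4-type edge** (`−(1/g_k²)G₃(g_kB)` of (2.12); also any term `g_k⁻²W(g_kB)` with `W` *«beginning with third
order terms»*): `W` analytic with `‖W‖ ≤ M` on `ball 0 R`, `BeginsAt W 3`, `3ε₁ ≤ R` ⟹ on the domain `‖g‖‖B‖ < ε₁`
the scaled term IS the quadratic form `Qop(B)(B, B)` of an operator with `‖Qop(B)‖ ≤ ½·27·(M/R³)·ε₁` — uniform in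
`g ≠ 0`, the `1/g_k²` cancelled ([II] p. 10), with a DERIVED cubic constant `M/R³`.
[cite: Balaban1987RG1, (2.12) p.268] -/
theorem quadraticForm_of_scaled_beginsAt_three {g : ℂ} (hg : g ≠ 0) {W : E → F} {R M ε₁ : ℝ} (hR : 0 < R)
    (hW : AnalyticOnNhd ℂ W (ball 0 R)) (hM : ∀ z ∈ ball (0 : E) R, ‖W z‖ ≤ M) (hB3 : BeginsAt W 3)
    (h3 : 3 * ε₁ ≤ R) {B : E} (hB : ‖g‖ * ‖B‖ < ε₁) :
    scaled g W B = Qop (scaled g W) B B B ∧ ‖Qop (scaled g W) B‖ ≤ 1 / 2 * (27 * (M / R ^ 3) * ε₁) := by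
  have hM0 : 0 ≤ M := nonneg_of_bound hR hM
  exact quadraticForm_of_scaled_cubic hg (by positivity) hR hW
    (cubic_bound_of_beginsAt_three hW.differentiableOn hM hB3) h3 hB

/-- The same edge in the REMAINDER reading (a third-order remainder `W − W^{(2)}` of a map beginning with quadratic
terms, e.g. `D₃ = D − D^{(2)}` of [I] p. 266): constant `2M/R³`. [cite: Balaban1987RG1, p.266] -/
theorem quadraticForm_of_scaled_rem_two {g : ℂ} (hg : g ≠ 0) {W : E → F} {R M ε₁ : ℝ} (hR : 0 < R)
    (hW : AnalyticOnNhd ℂ W (ball 0 R)) (hM : ∀ z ∈ ball (0 : E) R, ‖W z‖ ≤ M) (hB2 : BeginsAt W 2)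
    (h3 : 3 * ε₁ ≤ R) {B : E} (hB : ‖g‖ * ‖B‖ < ε₁) :
    scaled g (rem W 2) B = Qop (scaled g (rem W 2)) B B B ∧
      ‖Qop (scaled g (rem W 2)) B‖ ≤ 1 / 2 * (27 * (2 * M / R ^ 3) * ε₁) := by
  have hM0 : 0 ≤ M := nonneg_of_bound hR hM
  exact quadraticForm_of_scaled_cubic hg (by positivity) hR (analyticOnNhd_rem_two hR hW)
    (pow_bound_rem hW.differentiableOn hM hB2) h3 hB

end T4

/-! ## §3 T3 edge: `(1/g_k²)⟨H₁hD̃₃(g_kCB), J⟩` -/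

section T3

variable {F₁ F₂ G : Type*} [NormedAddCommGroup F₁] [NormedSpace ℂ F₁] [NormedAddCommGroup F₂] [NormedSpace ℂ F₂]
  [CompleteSpace F₂] [NormedAddCommGroup G] [NormedSpace ℂ G]

/-- A bounded linear map `C` with `‖C‖·R ≤ R_D` (`R_D > 0`) maps `ball 0 R` into `ball 0 R_D` (the field map
*«B′ = CB»* of p. 268 lands in `D̃`'s analyticity ball). [folklore] -/
theorem mapsTo_clm {R R_D : ℝ} (hRD : 0 < R_D) (C : E →L[ℂ] F₁) (hCR : ‖C‖ * R ≤ R_D) :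
    MapsTo C (ball (0 : E) R) (ball 0 R_D) :=
  mapsTo_ball_of_linear_bound (norm_nonneg C) hRD hCR fun w _ => C.le_opNorm w

/-- **T3 edge, cubic constant** (before scaling `B ↦ A(D̃₃(CB))`, `A = ⟨H₁h·, J⟩`, `D̃₃ = D̃ − D̃^{(2)} = rem D̃ 2`):
`D̃` complex-differentiable with `‖D̃‖ ≤ M` on `ball 0 R_D`, jet `D̃ 0 = 0`, `DD̃(0) = 0` ([II] p. 10), `‖C‖·R ≤ R_D`
⟹ `‖A(D̃₃(CB))‖ ≤ ‖A‖·(2M/R_D³·‖C‖³)·‖B‖³` on `ball 0 R` — `B13PkScaling.pow_bound_comp_clm` and `pow_bound_clm_comp`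
fed with the DERIVED constant of `B13ExpansionOrder.bounds_of_jet_two`. [cite: Balaban1987RG1, (2.12) p.268] -/
theorem cubic_bound_T3 {D : F₁ → F₂} {R_D M R : ℝ} (hRD : 0 < R_D) (hD : DifferentiableOn ℂ D (ball 0 R_D))
    (hM : ∀ z ∈ ball (0 : F₁) R_D, ‖D z‖ ≤ M) (h0 : D 0 = 0) (h1 : fderiv ℂ D 0 = 0) (C : E →L[ℂ] F₁)
    (hCR : ‖C‖ * R ≤ R_D) (A : F₂ →L[ℂ] G) :
    ∀ B ∈ ball (0 : E) R, ‖A (rem D 2 (C B))‖ ≤ ‖A‖ * (2 * M / R_D ^ 3 * ‖C‖ ^ 3) * ‖B‖ ^ 3 := by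
  have hM0 : 0 ≤ M := nonneg_of_bound hRD hM
  have hrem := (bounds_of_jet_two hRD hD hM h0 h1).2
  have hcomp := pow_bound_comp_clm (P := rem D 2) (by positivity) hrem C (mapsTo_clm hRD C hCR)
  exact pow_bound_clm_comp hcomp A

/-- The T3 composite `B ↦ A(D̃₃(CB))` is analytic on `ball 0 R` (for `D̃` analytic on `ball 0 R_D`, `‖C‖·R ≤ R_D`).
[folklore] -/
theorem analyticOnNhd_T3 {D : F₁ → F₂} {R_D R : ℝ} (hRD : 0 < R_D) (hD : AnalyticOnNhd ℂ D (ball 0 R_D))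
    (C : E →L[ℂ] F₁) (hCR : ‖C‖ * R ≤ R_D) (A : F₂ →L[ℂ] G) :
    AnalyticOnNhd ℂ (fun B => A (rem D 2 (C B))) (ball 0 R) := by
  intro z hz
  have h1 : AnalyticAt ℂ (rem D 2) (C z) := analyticOnNhd_rem_two hRD hD _ (mapsTo_clm hRD C hCR hz)
  have h2 : AnalyticAt ℂ (fun B => rem D 2 (C B)) z := h1.comp (C.analyticAt z)
  exact (A.analyticAt _).comp h2

/-- **T3 edge, scaled** ([II] (1.42)–(1.43) shape for this term): under the data of `cubic_bound_T3` with `D̃`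
analytic, `3ε₁ ≤ R`, on `‖g‖‖B‖ < ε₁` the scaled term `g⁻²A(D̃₃(C(gB)))` is `Qop(B)(B, B)` with
`‖Qop(B)‖ ≤ ½·27·(‖A‖·(2M/R_D³)·‖C‖³)·ε₁`, uniformly in `g ≠ 0`. [cite: Balaban1988RG2Cluster, (1.42)–(1.43) p.11] -/
theorem quadraticForm_T3 [CompleteSpace G] {g : ℂ} (hg : g ≠ 0) {D : F₁ → F₂} {R_D M R ε₁ : ℝ} (hRD : 0 < R_D)
    (hR : 0 < R) (hD : AnalyticOnNhd ℂ D (ball 0 R_D)) (hM : ∀ z ∈ ball (0 : F₁) R_D, ‖D z‖ ≤ M) (h0 : D 0 = 0)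
    (h1 : fderiv ℂ D 0 = 0) (C : E →L[ℂ] F₁) (hCR : ‖C‖ * R ≤ R_D) (A : F₂ →L[ℂ] G) (h3 : 3 * ε₁ ≤ R) {B : E}
    (hB : ‖g‖ * ‖B‖ < ε₁) :
    scaled g (fun B => A (rem D 2 (C B))) B = Qop (scaled g fun B => A (rem D 2 (C B))) B B B ∧
      ‖Qop (scaled g fun B => A (rem D 2 (C B))) B‖ ≤
        1 / 2 * (27 * (‖A‖ * (2 * M / R_D ^ 3 * ‖C‖ ^ 3)) * ε₁) := by
  have hM0 : 0 ≤ M := nonneg_of_bound hRD hM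
  exact quadraticForm_of_scaled_cubic hg (by positivity) hR (analyticOnNhd_T3 hRD hD C hCR A)
    (cubic_bound_T3 hRD hD.differentiableOn hM h0 h1 C hCR A) h3 hB

end T3

/-! ## §4 T5 / T6 edges: `⟨H₁g_kCB, Δ₁H₁hD̃(g_kCB)⟩`, `⟨H₁hD̃(g_kCB), Δ₁H₁hD̃(g_kCB)⟩` -/

section T56

variable {F₁ F₂ G₁ G₂ H : Type*} [NormedAddCommGroup F₁] [NormedSpace ℂ F₁] [NormedAddCommGroup F₂]
  [NormedSpace ℂ F₂] [CompleteSpace F₂] [NormedAddCommGroup G₁] [NormedSpace ℂ G₁] [NormedAddCommGroup G₂]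
  [NormedSpace ℂ G₂] [NormedAddCommGroup H] [NormedSpace ℂ H]

/-- **T5/T6 input after the field map**: `‖D̃(CB)‖ ≤ (M/R_D²)·‖C‖²·‖B‖²` on `ball 0 R` from the jet of `D̃` and
`‖C‖·R ≤ R_D`. [cite: Balaban1987RG1, (2.12) p.268] -/
theorem quadratic_bound_comp_T56 {D : F₁ → F₂} {R_D M R : ℝ} (hRD : 0 < R_D)
    (hD : DifferentiableOn ℂ D (ball 0 R_D)) (hM : ∀ z ∈ ball (0 : F₁) R_D, ‖D z‖ ≤ M) (h0 : D 0 = 0)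
    (h1 : fderiv ℂ D 0 = 0) (C : E →L[ℂ] F₁) (hCR : ‖C‖ * R ≤ R_D) :
    ∀ B ∈ ball (0 : E) R, ‖D (C B)‖ ≤ M / R_D ^ 2 * ‖C‖ ^ 2 * ‖B‖ ^ 2 := by
  have hM0 : 0 ≤ M := nonneg_of_bound hRD hM
  exact pow_bound_comp_clm (P := D) (by positivity) (bounds_of_jet_two hRD hD hM h0 h1).1 C
    (mapsTo_clm hRD C hCR)

/-- **T5 edge, cubic constant** (before scaling `B ↦ β(L₁B)(A₂(D̃(CB)))`, `L₁ = H₁C`, `A₂ = Δ₁H₁h`, `β` the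
pairing): `‖β(L₁B)(A₂(D̃(CB)))‖ ≤ ‖β‖·‖L₁‖·(‖A₂‖·(M/R_D²)·‖C‖²)·‖B‖³` on `ball 0 R`.
[cite: Balaban1987RG1, (2.12) p.268] -/
theorem cubic_bound_T5 {D : F₁ → F₂} {R_D M R : ℝ} (hRD : 0 < R_D) (hD : DifferentiableOn ℂ D (ball 0 R_D))
    (hM : ∀ z ∈ ball (0 : F₁) R_D, ‖D z‖ ≤ M) (h0 : D 0 = 0) (h1 : fderiv ℂ D 0 = 0) (C : E →L[ℂ] F₁)
    (hCR : ‖C‖ * R ≤ R_D) (L₁ : E →L[ℂ] G₁) (A₂ : F₂ →L[ℂ] G₂) (β : G₁ →L[ℂ] G₂ →L[ℂ] H) :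
    ∀ B ∈ ball (0 : E) R,
      ‖β (L₁ B) (A₂ (D (C B)))‖ ≤ ‖β‖ * ‖L₁‖ * (‖A₂‖ * (M / R_D ^ 2 * ‖C‖ ^ 2)) * ‖B‖ ^ 3 := by
  have hq := pow_bound_clm_comp (quadratic_bound_comp_T56 hRD hD hM h0 h1 C hCR) A₂
  exact cubic_bilin_lin_quad β (f := fun B => L₁ B) (fun w _ => L₁.le_opNorm w) hq

/-- **T6 edge, cubic constant** (before scaling `B ↦ β(A₁(D̃(CB)))(A₂(D̃(CB)))`, quadratic × quadratic):
with `b = (M/R_D²)·‖C‖²`, `‖β(A₁(D̃(CB)))(A₂(D̃(CB)))‖ ≤ ‖β‖·(‖A₁‖b)·(‖A₂‖b)·R·‖B‖³` on `ball 0 R`.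
[cite: Balaban1987RG1, (2.12) p.268] -/
theorem cubic_bound_T6 {D : F₁ → F₂} {R_D M R : ℝ} (hRD : 0 < R_D) (hD : DifferentiableOn ℂ D (ball 0 R_D))
    (hM : ∀ z ∈ ball (0 : F₁) R_D, ‖D z‖ ≤ M) (h0 : D 0 = 0) (h1 : fderiv ℂ D 0 = 0) (C : E →L[ℂ] F₁)
    (hCR : ‖C‖ * R ≤ R_D) (A₁ : F₂ →L[ℂ] G₁) (A₂ : F₂ →L[ℂ] G₂) (β : G₁ →L[ℂ] G₂ →L[ℂ] H) :
    ∀ B ∈ ball (0 : E) R,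
      ‖β (A₁ (D (C B))) (A₂ (D (C B)))‖ ≤
        ‖β‖ * (‖A₁‖ * (M / R_D ^ 2 * ‖C‖ ^ 2)) * (‖A₂‖ * (M / R_D ^ 2 * ‖C‖ ^ 2)) * R * ‖B‖ ^ 3 := by
  have hM0 : 0 ≤ M := nonneg_of_bound hRD hM
  have hq := quadratic_bound_comp_T56 hRD hD hM h0 h1 C hCR
  exact cubic_bilin_quad_quad β (by positivity) (by positivity) (pow_bound_clm_comp hq A₁)
    (pow_bound_clm_comp hq A₂)

end T56

/-! ## §5 T7-type edge, derived variant: `V(H₁B′)` with `V` beginning with third-order terms -/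

section T7

variable {F₁ F₂ : Type*} [NormedAddCommGroup F₁] [NormedSpace ℂ F₁] [NormedAddCommGroup F₂] [NormedSpace ℂ F₂]
  [CompleteSpace F₂]

omit [NormedSpace ℂ E] in
/-- **T7-type edge, derived variant** (`V(H₁(g_kCB − hD̃(g_kCB)))`, (2.8): *«terms of at least third order in H₁B′»*):
`V` complex-differentiable with `‖V‖ ≤ M` on `ball 0 R_V`, `BeginsAt V 3`, and a field map `Ψ` with the linear-order
bound `‖Ψ w‖ ≤ λ‖w‖` on `ball 0 R₀` ((1.20) of [II]), `0 ≤ λ`, `λR₀ ≤ R_V` ⟹ `‖V(Ψ w)‖ ≤ (M/R_V³)·λ³·‖w‖³` on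
`ball 0 R₀` — `B13PkScaling.cubic_comp_of_linear_bound` with the DERIVED constant `M/R_V³` (the parent's
`norm_Qop_T7_le` takes instead the PRINTED bound (1.39)). [cite: Balaban1987RG1, (2.8) p.266] -/
theorem cubic_bound_T7_derived {V : F₁ → F₂} {R_V M : ℝ} (hRV : 0 < R_V)
    (hV : DifferentiableOn ℂ V (ball 0 R_V)) (hM : ∀ z ∈ ball (0 : F₁) R_V, ‖V z‖ ≤ M) (hB3 : BeginsAt V 3)
    {Ψ : E → F₁} {R₀ lam : ℝ} (hlam : 0 ≤ lam) (hR : lam * R₀ ≤ R_V)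
    (hΨ : ∀ w ∈ ball (0 : E) R₀, ‖Ψ w‖ ≤ lam * ‖w‖) :
    ∀ w ∈ ball (0 : E) R₀, ‖V (Ψ w)‖ ≤ M / R_V ^ 3 * lam ^ 3 * ‖w‖ ^ 3 := by
  have hM0 : 0 ≤ M := nonneg_of_bound hRV hM
  exact cubic_comp_of_linear_bound (by positivity) (cubic_bound_of_beginsAt_three hV hM hB3) hΨ
    (mapsTo_ball_of_linear_bound hlam hRV hR hΨ)

end T7

end Literature.MathematicalPhysics.QuantumFieldTheory.Balaban1983to89.B13PkOrderEdges
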